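/-
Copyright: statement-level skeleton of a published paper (lit-balaban cell, Phase-2 proof seat p18, gen 7). No claims beyond
what the kernel checks below.
-/
import Mathlib
import Literature.MathematicalPhysics.QuantumFieldTheory.Balaban1983to89.B3Prop22FreeLinesSingle
import Literature.MathematicalPhysics.QuantumFieldTheory.Balaban1983to89.B3IBPZeroBoxGraph24

/-!
# B3 — T. Bałaban, *(Higgs)₂,₃ quantum fields in a finite volume. III. Renormalization*, CMP **88** (1983) 411–445
[Balaban1983Higgs3] — Proposition 2.2 p. 428: the print-strength generalized class INHABITED BY THE GENUINE PROPAGATOR PIECES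
of the zero-field box class, with free line exponents

statement-level skeleton of published theorems with citation tags; proofs where landed; nothing here is a claim about
the Yang–Mills mass gap

PDF held: `paper:balaban1983-higgs-2-3-quantum-fields-finite-volume` (journal page = PDF page + 410); p. 428 [PDF 18] read on the
materialised text.

Part of the Phase-2 work on SKELETON row **B3.Prop2.2** (closing item «free line exponent κ_l», print-strength companion; unit
`lit-balaban-p18` gen 7, HOME `run/shared/lean/pub/lit-balaban/`), file 3 of the companion after `B3FreeLineSingle` /
`B3Prop22FreeLinesSingle`, joining them to seat p19 gen 5's `B3IBPZeroBox` / `B3IBPZeroBoxGraph24`.  Own namespace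
`…B3FreeLineZeroBox` (plus two declarations in `…B3Ineq213`); definitions with bodies and theorems; no `def … : Prop`; nothing
existing is modified.

WHAT IS REPRODUCED.  Proposition 2.2 p. 428 [PDF 18]: *"We can have lines with the same exponential factors but with arbitrary
dimensions instead of −d+2. The only thing which matters is that propagators have representations corresponding to (2.6) with the
estimates corresponding to (2.10)–(2.12) …"*.  `B3Prop22FreeLinesSingle.prop22_freeLines₁` proved Prop. 2.2 for the family `famK₁`
whose datum supplies, for EVERY abstract generalized graph (connected count datum `G`, extra exponents `κ_l` from a finite menu),
a print-strength IBP-ready amplitude `IBPAmpK₁ G κ` — the analytic side being data, as in p19 gen 4.  p19 gen 5 DERIVED that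
analytic side for the zero-field box class (`B3IBPZeroBox.iboxAmp : IBPAmp₁ (zbCounts Γ …)`: line kernels = the lattice
difference quotients of the cut-off pieces `ζ(x)ζ(y)η^{−(d+1)}G^η_{(t)}(□,0;x,y)`, every class field proved).  HERE the two are
joined:
* `kbdK_of_le`, **`IBPAmp₁.toK₁Of`**: the bound (2.10) `|F| ≤ C (L^tη)^e e^{−…}` only weakens when the dimension `e` is lowered
  (`L^tη ≤ 1`), so a print-strength amplitude over `G` with the standard dimensions `a_l` IS one over the generalized graph
  `G.toModelK κ` (dimensions `a_l + κ_l`) for EVERY `κ ≤ 0` — same kernels, same constants (`toK₁Of_K`, `toK₁Of_EtotM`);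
* the generalized zero-field box class: parameters `ParamsZK` (p19's `ParamsZB` + the menu), graphs **`CGraphZK`** (p19's
  `SDGraph`s — lines with endpoints, at most one derivative leg per vertex — with `m ≤ mb` lines AND an extra exponent
  `κ_l ∈ menu`, `κ_l ≤ 0`, per line), their images `CGraphZK.toK₁` in the graph class `CGraphK₁` of `famK₁`, the amplitudes
  **`ampK D G box : IBPAmpK₁ G.counts G.κ`** (p19's datum `DatumZB`: scale, window point, box, couplings, vertex data; lines =
  `zbK`, `ampK_K`), the expansion `expansionZK` of r15's carrier (degrees `degQK`, exception `Is24K`) and the family **`famZK`**;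
* **`prop21_zeroBoxK : B3Prop1.Prop21 (famZK P mbar)`**, **`prop22_zeroBoxK`** — with LITERALLY the constants of
  `prop21_freeLines₁ P.toK` (`δ₀ = ½δ₁`, `O(1)(n̄) = unifO1K P.toK (mbar n̄)`) and by the same theorem
  `IBPAmpK₁.abs_EtotM_le_unifO1K`; the printed hypothesis on a graph of `famZK` is verbatim the hypothesis of `famK₁` on its image
  (`posSubgraphsExcept24_iff_toK₁`), and on p19's graphs with `κ ≡ 0` verbatim p19's (`posSubgraphsExcept24_ofZB_zero_iff`), the
  amplitude being p19's (`E_ofZB`);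
* NON-VACUITY BY ACTUAL PROPAGATORS: (i) the graph (2.4) with its genuine doubly differenced line, `κ ≡ 0`, satisfies the
  hypothesis through the exception clause and gets (1.33) (`ineq133At_member24K`); lowering the dimension of its line (`κ < 0`)
  voids the exception, as it must (`not_posSubgraphsExcept24_member24K_of_neg`); (ii) (companion file
  `B3Prop22FreeLinesZeroBoxExample`) the one-line graph with the genuine UNdifferentiated piece has degree `2` in every dimension,
  so with any menu exponent `−2 < κ ≤ 0` on its line the generalized degree `2 + κ` is positive and (1.33) holds for it with NO
  exception — a member of the generalized family with a genuinely shifted line dimension and a genuine propagator.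
HONEST SCOPE: `κ_l ≤ 0` only — the genuine cut-off pieces obey (2.10) with every dimension BELOW the true one; lines of LARGER
dimension than `−d+2` (the subtracted / renormalized propagators to which Sect. 3 applies Prop. 2.2) are different kernels, not in
the tree; zero background field and a box only, scalar lines only, vertex side = p19's datum (as in `B3IBPZeroBox`).  Why not a
member of `famK₁` itself: its datum must serve every ABSTRACT count datum, and genuine kernels exist only for count data of
geometric origin (`zbCounts Γ`; the bond directions are not even recorded in the counts) — the generalized class is therefore
instantiated, exactly as p19 instantiated gen 4's, by a sibling family over the geometric graphs, built from the same amplitude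
class, hypothesis, constants and theorem.
-/

open Finset

namespace Literature.MathematicalPhysics.QuantumFieldTheory.Balaban1983to89

/-! ## §1 (2.10) weakens when the dimension is lowered; the bridge with free nonpositive exponents -/

namespace B3Ineq213

open B3Ineq215 B3FreeLine

variable {V : Type} [Fintype V] [DecidableEq V] {m : ℕ}

/-- **(2.10) with the dimension `e` implies (2.10) with every dimension `e′ ≤ e`** over the generalized graph (`L^tη ≤ 1` for the
scale indices `t < k` of (2.6)). [cite: Balaban1983Higgs3, (2.10) p.426] -/
theorem kbdK_of_le {G : Counts V m} (κ : Fin m → ℚ) {k : ℕ} {C e e' : ℝ} {F : Ker G.toModel.d}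
    (h : KBd G.toModel k C e F) (hC : 0 ≤ C) (he : e' ≤ e) : KBd (G.toModelK κ) k C e' F := by
  intro t ht x y
  refine (h t ht x y).trans ?_
  rw [toModelK_sc, toModelK_δ₀, toModelK_L]
  have hs0 : 0 < G.toModel.sc k t := G.toModel.sc_pos k t
  have hs1 : G.toModel.sc k t ≤ 1 := G.toModel.sc_le_one ht.le
  have hpow : G.toModel.sc k t ^ e ≤ G.toModel.sc k t ^ e' := Real.rpow_le_rpow_of_exponent_ge hs0 hs1 he
  exact mul_le_mul_of_nonneg_right (mul_le_mul_of_nonneg_left hpow hC) (Real.exp_pos _).le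

/-- **A print-strength IBP-ready amplitude over a count datum with the standard line dimensions (p19's `IBPAmp₁ G`) is one over
the generalized graph with ANY nonpositive extra exponents `κ_l ≤ 0`** (line dimensions `a_l + κ_l`): the same kernels, vertex
functions and constants; every bound of the class only weakens. [cite: Balaban1983Higgs3, Prop. 2.2 p.428] -/
noncomputable def IBPAmp₁.toK₁Of {G : Counts V m} (A : IBPAmp₁ G) (κ : Fin m → ℚ) (hκ : ∀ l, κ l ≤ 0) :
    IBPAmpK₁ G κ where
  k := A.k
  box := A.box
  u := A.u
  K := A.K
  C := A.C
  eRun := A.eRun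
  lamRun := A.lamRun
  dv := A.dv
  ds := A.ds
  NPhi := A.NPhi
  NA := A.NA
  C_nonneg := A.C_nonneg
  eRun_nonneg := A.eRun_nonneg
  lamRun_nonneg := A.lamRun_nonneg
  NPhi_nonneg := A.NPhi_nonneg
  NA_nonneg := A.NA_nonneg
  e_nonneg := A.e_nonneg
  conn := A.conn
  u_le := A.u_le
  K_le := fun l t ht x x' => by
    have h0 : ((κ l : ℚ) : ℝ) ≤ 0 := by exact_mod_cast hκ l
    have hK : KBd G.toModel A.k (A.C l) (G.toModel.a l) (A.K l) := fun t' ht' y y' => A.K_le l t' ht' y y'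
    have h := kbdK_of_le κ hK (A.C_nonneg l) (show G.toModel.a l + ((κ l : ℚ) : ℝ) ≤ G.toModel.a l by linarith)
    exact h t ht x x'
  dir := A.dir
  Kb := A.Kb
  cD := A.cD
  one_le_cD := A.one_le_cD
  single := A.single
  K_eq := A.K_eq
  Kb_le := fun l hne hd => by
    have h0 : ((κ l : ℚ) : ℝ) ≤ 0 := by exact_mod_cast hκ l
    exact kbdK_of_le κ (A.Kb_le l hne hd) (A.C_nonneg l)
      (show G.toModel.a l + ((κ l : ℚ) : ℝ) + 1 ≤ G.toModel.a l + 1 by linarith)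
  u_face := A.u_face
  du_le := A.du_le
  KdX_le := fun l μ h => by
    have h0 : ((κ l : ℚ) : ℝ) ≤ 0 := by exact_mod_cast hκ l
    exact kbdK_of_le κ (A.KdX_le l μ h) (A.C_nonneg l)
      (show G.toModel.a l + ((κ l : ℚ) : ℝ) - 1 ≤ G.toModel.a l - 1 by linarith)
  KdY_le := fun l ν h => by
    have h0 : ((κ l : ℚ) : ℝ) ≤ 0 := by exact_mod_cast hκ l
    exact kbdK_of_le κ (A.KdY_le l ν h) (A.C_nonneg l)
      (show G.toModel.a l + ((κ l : ℚ) : ℝ) - 1 ≤ G.toModel.a l - 1 by linarith)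
  KdXY_le := fun l μ ν hx hy => by
    have h0 : ((κ l : ℚ) : ℝ) ≤ 0 := by exact_mod_cast hκ l
    exact kbdK_of_le κ (A.KdXY_le l μ ν hx hy) (A.C_nonneg l)
      (show G.toModel.a l + ((κ l : ℚ) : ℝ) - 2 ≤ G.toModel.a l - 2 by linarith)

/-- The bridge keeps the line kernels. [cite: Balaban1983Higgs3, (2.10) p.426] -/
theorem IBPAmp₁.toK₁Of_K {G : Counts V m} (A : IBPAmp₁ G) (κ : Fin m → ℚ) (hκ : ∀ l, κ l ≤ 0) :
    (A.toK₁Of κ hκ).K = A.K := rfl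

/-- The bridge keeps the amplitude at every scale assignment. [cite: Balaban1983Higgs3, (2.7) p.424] -/
theorem IBPAmp₁.toK₁Of_E {G : Counts V m} (A : IBPAmp₁ G) (κ : Fin m → ℚ) (hκ : ∀ l, κ l ≤ 0) (j : Fin m → ℕ) :
    (A.toK₁Of κ hκ).E j = A.E j := rfl

/-- The bridge keeps the total amplitude. [cite: Balaban1983Higgs3, (2.6) p.424] -/
theorem IBPAmp₁.toK₁Of_EtotM {G : Counts V m} (A : IBPAmp₁ G) (κ : Fin m → ℚ) (hκ : ∀ l, κ l ≤ 0) :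
    (A.toK₁Of κ hκ).toAmp.EtotM = A.toAmp.Etot := rfl

/-- The bridge keeps the prefactor of (1.33). [cite: Balaban1983Higgs3, (1.33) p.420] -/
theorem IBPAmp₁.toK₁Of_prefM {G : Counts V m} (A : IBPAmp₁ G) (κ : Fin m → ℚ) (hκ : ∀ l, κ l ≤ 0) :
    (A.toK₁Of κ hκ).toAmp.prefM = A.toAmp.pref := rfl

end B3Ineq213

/-! ## §2 The generalized zero-field box class: graphs, amplitudes, the family, Proposition 2.2 -/

namespace B3FreeLineZeroBox

open B3Ineq215 B3Ineq213 B3FreeLine B3Sect2FirstEstimate B3Prop1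
open B3Ineq213ZeroBoxLines (twoVertexGraph)
open B3IBPZeroBox B3IBPZeroBoxKernels B3IBPZeroBoxGraph24

noncomputable section

/-- **The parameters of the generalized family**: p19's `ParamsZB` (dimension `d + 1`, `L = ℓ + 1`, window, `CD`) and the finite
menu of admissible extra line exponents. [cite: Balaban1983Higgs3, Prop. 2.2 p.428] -/
structure ParamsZK extends ParamsZB where
  /-- the finite set of admissible extra line exponents `κ_l` -/
  menu : Finset ℚ

namespace ParamsZK

variable (P : ParamsZK)

/-- The parameters of `famK₁` determined by ours (`Cmax := Cz`, the menu). [cite: Balaban1983Higgs3, Prop. 2.2 p.428] -/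
def toK : ParamsK where
  toParamsIBP := P.toIBP
  menu := P.menu

end ParamsZK

/-- **The generalized graphs of the zero-field box class** at the size bound `mb`: a graph of p19's class (`SDGraph` on `Fin n`,
`m ≤ mb` lines) with an extra exponent `κ_l ∈ menu`, `κ_l ≤ 0`, on every line — *"lines with the same exponential factors but
with arbitrary dimensions"* `a_l + κ_l`. [cite: Balaban1983Higgs3, Prop. 2.2 p.428] -/
structure CGraphZK (P : ParamsZK) (mb : ℕ) extends CGraphZB P.toParamsZB mb where
  /-- the extra line exponents -/
  κ : Fin m → ℚ
  /-- taken from the menu -/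
  κ_mem : ∀ l, κ l ∈ P.menu
  /-- the genuine pieces obey (2.10) with every LOWER dimension -/
  κ_nonpos : ∀ l, κ l ≤ 0

namespace CGraphZK

variable {P : ParamsZK} {mb : ℕ} (G : CGraphZK P mb)

/-- The count datum of the graph (p19's `zbCounts`). [cite: Balaban1983Higgs3, (2.14) p.427] -/
abbrev counts : Counts (Fin G.n) G.m := G.toCGraphZB.counts

/-- A graph of p19's class with a constant admissible exponent on its lines is a generalized graph (`q = 0`: the standard
dimensions). [cite: Balaban1983Higgs3, Prop. 2.2 p.428] -/
def ofZB (G : CGraphZB P.toParamsZB mb) (q : ℚ) (hq : q ∈ P.menu) (hq0 : q ≤ 0) : CGraphZK P mb where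
  toCGraphZB := G
  κ := fun _ => q
  κ_mem := fun _ => hq
  κ_nonpos := fun _ => hq0

/-- **Every generalized graph of the zero-field box class is a graph of the class of `famK₁`** (connected count datum with the
lattice constants of `P.toK`, menu-valued `κ`, one derivative leg per vertex). [cite: Balaban1983Higgs3, Prop. 2.2 p.428] -/
def toK₁ : CGraphK₁ P.toK mb where
  n := G.n
  m := G.m
  m_le := G.m_le
  G := G.counts
  d_eq := rfl
  L_eq := rfl
  δ₁_eq := rfl
  conn := G.Γ.conn
  κ := G.κ
  κ_mem := G.κ_mem
  single := fun v l l' hne h1 => zbCounts_single G.Γ P.ℓ P.hℓ P.amin P.aplus P.m2plus P.ha v l l' hne h1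

end CGraphZK

/-- **The amplitude of a generalized graph of the zero-field box class** at the datum `D` and localization `box`: p19's `iboxAmp`
(lines = the difference quotients `zbK` of the cut-off zero-field box pieces, every analytic class field proved) read over the
generalized graph through `IBPAmp₁.toK₁Of` — an amplitude of the print-strength class `IBPAmpK₁ G.counts G.κ` of `famK₁`.
[cite: Balaban1983Higgs3, Prop. 2.2 p.428, (2.10) p.426] -/
def ampK {P : ParamsZK} {mb : ℕ} (D : DatumZB P.toParamsZB) (G : CGraphZK P mb) (box : Fin G.n → Fin (P.d + 1) → ℕ) :
    IBPAmpK₁ G.counts G.κ :=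
  (D.amp G.toCGraphZB box).toK₁Of G.κ G.κ_nonpos

/-- **The lines of `ampK` ARE the difference quotients of the cut-off zero-field box pieces.** [cite: Balaban1983Higgs3, (2.10) p.426] -/
theorem ampK_K {P : ParamsZK} {mb : ℕ} (D : DatumZB P.toParamsZB) (G : CGraphZK P mb)
    (box : Fin G.n → Fin (P.d + 1) → ℕ) (l : Fin G.m) : (ampK D G box).K l = zbK G.Γ P.ℓ D.k D.M D.a D.m2 l := rfl

/-- The kernel constants of `ampK` are p19's `Cz = Cmax`. [cite: Balaban1983Higgs3, (2.10) p.426] -/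
theorem ampK_C {P : ParamsZK} {mb : ℕ} (D : DatumZB P.toParamsZB) (G : CGraphZK P mb)
    (box : Fin G.n → Fin (P.d + 1) → ℕ) (l : Fin G.m) :
    (ampK D G box).C l = Cz P.d P.ℓ P.hℓ P.amin P.aplus P.m2plus P.ha := rfl

/-- The total amplitude of `ampK` is p19's total amplitude (the extra exponents change the BOUNDS, not the kernels).
[cite: Balaban1983Higgs3, (2.6) p.424] -/
theorem ampK_EtotM {P : ParamsZK} {mb : ℕ} (D : DatumZB P.toParamsZB) (G : CGraphZK P mb)
    (box : Fin G.n → Fin (P.d + 1) → ℕ) : (ampK D G box).toAmp.EtotM = (D.amp G.toCGraphZB box).toAmp.Etot := rfl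

/-- **The multi-graph expansion of r15's carrier for the generalized zero-field box class** (datum `D`, size bound `mb`): classes =
graphs = `CGraphZK P mb`; `E({G}, {□(v)}, ·, ·)` = the total amplitude of `ampK`; `d({□(v)})` = `boxTreeLen`; norms and orders from
the vertex data; connected subgraphs = the components of the `G_i` along every ordering with the GENERALIZED degrees `degQK`;
`Is24 := Is24K`. [cite: Balaban1983Higgs3, Prop. 2.2 p.428] -/
def expansionZK (P : ParamsZK) (mb : ℕ) (D : DatumZB P.toParamsZB) : GraphExpansion where
  eRun := D.eRun
  lamRun := D.lamRun
  eRun_pos := D.eRun_pos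
  lamRun_pos := D.lamRun_pos
  RenClass := CGraphZK P mb
  Loc := fun G => Fin G.n → Fin (P.d + 1) → ℕ
  ExtS := Unit
  ExtV := Unit
  E := fun G box _ _ => (ampK D G box).toAmp.EtotM
  ds := fun G => ∑ v, (D.vtx G.Γ boxZ).ds v
  dv := fun G => ∑ v, (D.vtx G.Γ boxZ).dv v
  treeLen := fun _ box => boxTreeLen (P.ℓ + 1) D.k box
  treeLen_nonneg := fun _ box => boxTreeLen_nonneg (P.ℓ + 1) D.k box
  normS := fun _ G box _ => ∏ v, (D.vtx G.Γ box).NPhi v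
  normV := fun _ G box _ => ∏ v, (D.vtx G.Γ box).NA v
  normS_nonneg := fun _ G box _ => prod_nonneg fun v _ => (D.vtx G.Γ box).NPhi_nonneg v
  normV_nonneg := fun _ G box _ => prod_nonneg fun v _ => (D.vtx G.Γ box).NA_nonneg v
  Graph := CGraphZK P mb
  single := id
  Connected := fun _ => True
  Sub := fun G => Component G.counts
  subDeg := fun G H => degQK (relabelCounts G.counts H.1) (G.κ ∘ H.1) H.2.1 H.2.2.1
  Is24 := fun G H => Is24K (relabelCounts G.counts H.1) (G.κ ∘ H.1) H.2.1 H.2.2.1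

/-- The family `fam n̄ D` of r15's `Prop22`/`Prop21`: at level `n̄` the generalized graphs have at most `mbar n̄` lines.
[cite: Balaban1983Higgs3, Prop. 2.2 p.428] -/
def famZK (P : ParamsZK) (mbar : ℕ → ℕ) : ℕ → DatumZB P.toParamsZB → GraphExpansion :=
  fun nbar D => expansionZK P (mbar nbar) D

/-- **The amplitude of a graph of p19's class read in the generalized family IS p19's amplitude** (any constant exponent).
[cite: Balaban1983Higgs3, (2.6) p.424] -/
theorem E_ofZB {P : ParamsZK} {mb : ℕ} (D : DatumZB P.toParamsZB) (G : CGraphZB P.toParamsZB mb) (q : ℚ) (hq : q ∈ P.menu)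
    (hq0 : q ≤ 0) (box : Fin G.n → Fin (P.d + 1) → ℕ) :
    (expansionZK P mb D).E (CGraphZK.ofZB G q hq hq0) box () () = (expansionZB P.toParamsZB mb D).E G box () () := rfl

/-- **The printed hypothesis on a generalized graph of the zero-field box class is verbatim the hypothesis of `famK₁` on its
image** (same components, same generalized degrees, same exception). [cite: Balaban1983Higgs3, Prop. 2.1 p.424] -/
theorem posSubgraphsExcept24_iff_toK₁ {P : ParamsZK} {mb : ℕ} (D : DatumZB P.toParamsZB) (D' : DatumK₁ P.toK)
    (G : CGraphZK P mb) :
    PosSubgraphsExcept24 (expansionZK P mb D) G ↔ PosSubgraphsExcept24 (expansionK₁ P.toK mb D') G.toK₁ := Iff.rfl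

/-- **On p19's graphs with `κ ≡ 0` the printed hypothesis of the generalized family is p19's** (`Is24K ↔ Is24Block`,
`degQK = degQ`). [cite: Balaban1983Higgs3, Prop. 2.1 p.424] -/
theorem posSubgraphsExcept24_ofZB_zero_iff {P : ParamsZK} {mb : ℕ} (D : DatumZB P.toParamsZB) (G : CGraphZB P.toParamsZB mb)
    (h0 : (0 : ℚ) ∈ P.menu) :
    PosSubgraphsExcept24 (expansionZK P mb D) (CGraphZK.ofZB G 0 h0 le_rfl)
      ↔ PosSubgraphsExcept24 (expansionZB P.toParamsZB mb D) G := by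
  change (True ∧ ∀ H : Component G.counts,
      Is24K (relabelCounts G.counts H.1) ((fun _ : Fin G.m => (0 : ℚ)) ∘ H.1) H.2.1 H.2.2.1 ∨
        0 < degQK (relabelCounts G.counts H.1) ((fun _ : Fin G.m => (0 : ℚ)) ∘ H.1) H.2.1 H.2.2.1) ↔
    (True ∧ ∀ H : Component G.counts,
      Is24Block (relabelCounts G.counts H.1) H.2.1 H.2.2.1 ∨ 0 < degQ (relabelCounts G.counts H.1) H.2.1 H.2.2.1)
  refine and_congr Iff.rfl (forall_congr' fun H => or_congr ?_ ?_)
  · exact ⟨fun h => h.1, fun h => ⟨h, fun _ _ => rfl⟩⟩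
  · simp [degQK]

/-- The printed hypothesis, read on the expansion: every component of every `G_i` along every ordering is a (2.4)-block of the
generalized graph or has positive (ℝ-valued) generalized degree. [cite: Balaban1983Higgs3, Prop. 2.1 p.424] -/
theorem hyp_of_posSubgraphsExcept24_zk {P : ParamsZK} {mb : ℕ} {D : DatumZB P.toParamsZB} {G : CGraphZK P mb}
    (h : PosSubgraphsExcept24 (expansionZK P mb D) G) (σ : Equiv.Perm (Fin G.m)) :
    ∀ i, i ≤ G.m → ∀ b ∈ ((relabelCounts G.counts σ).toModelK (G.κ ∘ σ)).reps i,
      ((relabelCounts G.counts σ).toModelK (G.κ ∘ σ)).Nontriv i b →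
      Is24K (relabelCounts G.counts σ) (G.κ ∘ σ) i b ∨ 0 < ((relabelCounts G.counts σ).toModelK (G.κ ∘ σ)).D i b := by
  intro i hi b hb hn
  rw [reps_toModelK] at hb
  rw [nontriv_toModelK] at hn
  rcases h.2 ⟨σ, ⟨i, Nat.lt_succ_of_le hi⟩, ⟨b, hb, hn⟩⟩ with h24 | hpos
  · exact Or.inl h24
  · right
    have hc := cast_degQK (relabelCounts G.counts σ) (G.κ ∘ σ) i b
    have h0 : (0 : ℝ) < ((degQK (relabelCounts G.counts σ) (G.κ ∘ σ) i b : ℚ) : ℝ) := by exact_mod_cast hpos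
    rw [hc] at h0
    exact h0

/-- **Proposition 2.2 for the generalized zero-field box class — r15's `B3Prop1.Prop21` INHABITED with free line exponents AND
genuine propagators**: `δ₀ := ½δ₁` first; given α₀ and n̄ the constant `O(1)(n̄) := unifO1K P.toK (mbar n̄)` OF `famK₁`; then for
every datum of p19's class (scale `k ≥ 1`, window point, box, couplings, vertex data) and every generalized graph (an `SDGraph`
with at most `mbar n̄` lines and menu exponents `κ_l ≤ 0`) all of whose components have positive GENERALIZED degree OR ARE
(2.4)-BLOCKS, (1.33) for all localizations — the line kernels being the genuine difference quotients of the cut-off zero-field box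
pieces, bounded with the dimensions `a_l + κ_l`. [cite: Balaban1983Higgs3, Prop. 2.2 p.428] -/
theorem prop21_zeroBoxK (P : ParamsZK) (mbar : ℕ → ℕ) : Prop21 (famZK P mbar) := by
  classical
  refine ⟨P.toK.δ₁ / 2, half_pos P.toK.δ₁_pos, fun α₀ _ _ nbar => ?_⟩
  refine ⟨unifO1K P.toK (mbar nbar), unifO1K_pos P.toK (mbar nbar), fun D G hG => ?_⟩
  intro box Φ Aext
  change Fin G.n → Fin (P.d + 1) → ℕ at box
  set A : IBPAmpK₁ G.counts G.κ := ampK D G box with hA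
  have hyp := fun σ => hyp_of_posSubgraphsExcept24_zk hG σ
  have hfin : |A.toAmp.EtotM| ≤ unifO1K P.toK (mbar nbar) * A.toAmp.prefM :=
    A.abs_EtotM_le_unifO1K P.toK rfl rfl rfl G.m_le G.κ_mem (fun l => le_rfl) (D.vtx_cD_le G.Γ box) hyp
  show |A.toAmp.EtotM| ≤ unifO1K P.toK (mbar nbar) * D.eRun ^ (∑ v, (D.vtx G.Γ boxZ).dv v)
      * D.lamRun ^ (∑ v, (D.vtx G.Γ boxZ).ds v) * Real.exp (-(P.toK.δ₁ / 2 * boxTreeLen (P.ℓ + 1) D.k box))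
      * (∏ v, (D.vtx G.Γ box).NPhi v) * (∏ v, (D.vtx G.Γ box).NA v)
  have e : A.toAmp.prefM = D.eRun ^ (∑ v, (D.vtx G.Γ boxZ).dv v) * D.lamRun ^ (∑ v, (D.vtx G.Γ boxZ).ds v)
      * Real.exp (-(P.toK.δ₁ / 2 * boxTreeLen (P.ℓ + 1) D.k box)) * (∏ v, (D.vtx G.Γ box).NPhi v)
      * (∏ v, (D.vtx G.Γ box).NA v) := by
    rw [show A.toAmp.prefM = (D.amp G.toCGraphZB box).toAmp.pref from rfl]
    have he : (D.amp G.toCGraphZB box).eRun = D.eRun := D.vtx_eRun G.Γ box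
    have hl : (D.amp G.toCGraphZB box).lamRun = D.lamRun := D.vtx_lamRun G.Γ box
    have hdv : (D.amp G.toCGraphZB box).dv = (D.vtx G.Γ boxZ).dv := D.vtx_dv G.Γ box boxZ
    have hds : (D.amp G.toCGraphZB box).ds = (D.vtx G.Γ boxZ).ds := D.vtx_ds G.Γ box boxZ
    unfold Amp.pref
    rw [he, hl, hdv, hds]
    rfl
  calc |A.toAmp.EtotM| ≤ unifO1K P.toK (mbar nbar) * A.toAmp.prefM := hfin
    _ = _ := by rw [e]; ring

/-- **Proposition 2.2** p. 428 — r15's `B3Prop1.Prop22` INHABITED by the generalized zero-field box class (free nonpositive line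
exponents, genuine propagator pieces). [cite: Balaban1983Higgs3, Prop. 2.2 p.428] -/
theorem prop22_zeroBoxK (P : ParamsZK) (mbar : ℕ → ℕ) : Prop22 (famZK P mbar) :=
  prop21_zeroBoxK P mbar

/-- The datum type of the family is p19's, inhabited for `a₋ ≤ a₊`, `0 ≤ m²₊`, `1 ≤ CD`. [cite: Balaban1983Higgs3, Prop. 2.1 p.424] -/
theorem datum_nonempty (P : ParamsZK) (hw : P.amin ≤ P.aplus) (hm : 0 ≤ P.m2plus) (hD : 1 ≤ P.CD) :
    Nonempty (DatumZB P.toParamsZB) :=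
  datumZB_nonempty P.toParamsZB hw hm hD

/-! ## §3 The graph (2.4) with its genuine line in the generalized family -/

section Graph24

variable (P : ParamsZK) (μ' ν' : Fin (P.d + 1))

/-- **(2.4) with its genuine doubly differenced cut-off propagator piece and the standard dimension (`κ ≡ 0`) satisfies the
PRINTED hypothesis in the generalized family** — through the exception clause `Is24K`. [cite: Balaban1983Higgs3, (2.4) p.424] -/
theorem posSubgraphsExcept24_member24K (h0 : (0 : ℚ) ∈ P.menu) {mb : ℕ} (h : 1 ≤ mb) (D : DatumZB P.toParamsZB) :
    PosSubgraphsExcept24 (expansionZK P mb D) (CGraphZK.ofZB (member24 P.toParamsZB μ' ν' h) 0 h0 le_rfl) :=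
  (posSubgraphsExcept24_ofZB_zero_iff D _ h0).2 (posSubgraphsExcept24_member24 P.toParamsZB μ' ν' h D)

/-- Its line in the generalized family is the genuine kernel `∂⁺_{μ,x}∂⁺_{ν,y}[ζ(x)ζ(y)η^{−(d+1)}G^η_{(t)}(□,0;x,y)]`.
[cite: Balaban1983Higgs3, (2.4) p.424, (2.10) p.426] -/
theorem ampK_K_member24 (q : ℚ) (hq : q ∈ P.menu) (hq0 : q ≤ 0) {mb : ℕ} (h : 1 ≤ mb) (D : DatumZB P.toParamsZB)
    (box : Fin 2 → Fin (P.d + 1) → ℕ) :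
    (ampK D (CGraphZK.ofZB (member24 P.toParamsZB μ' ν' h) q hq hq0) box).K (0 : Fin 1)
      = fdX (s₀ P.ℓ D.k) μ' (fdY (s₀ P.ℓ D.k) ν' (cutK P.ℓ D.k D.M D.a D.m2)) :=
  amp_K_zb24 P.toParamsZB μ' ν' h D box

/-- **(1.33) for the graph (2.4) with its genuine line, from Proposition 2.2 for the generalized family** (`κ ≡ 0`), for every
datum of p19's class. [cite: Balaban1983Higgs3, Prop. 2.2 p.428] -/
theorem ineq133At_member24K (h0 : (0 : ℚ) ∈ P.menu) (mbar : ℕ → ℕ) :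
    ∃ δ₀ : ℝ, 0 < δ₀ ∧ ∀ α₀ : ℝ, 0 < α₀ → α₀ < 1 → ∀ nbar : ℕ, ∃ C : ℝ, 0 < C ∧
      ∀ (D : DatumZB P.toParamsZB) (h : 1 ≤ mbar nbar),
        Ineq133At (famZK P mbar nbar D).toExpansion (CGraphZK.ofZB (member24 P.toParamsZB μ' ν' h) 0 h0 le_rfl) α₀ δ₀ C := by
  obtain ⟨δ₀, hδ, H⟩ := prop21_zeroBoxK P mbar
  refine ⟨δ₀, hδ, fun α₀ ha0 ha1 nbar => ?_⟩
  obtain ⟨C, hC, HC⟩ := H α₀ ha0 ha1 nbar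
  exact ⟨C, hC, fun D h => HC D _ (posSubgraphsExcept24_member24K P μ' ν' h0 h D)⟩

/-- **Lowering the dimension of the line of (2.4) voids the exception**: with an exponent `κ < 0` on it the block is no longer a
(2.4)-block of the generalized graph (`Is24K` asks `κ = 0` on its line) and its generalized degree `κ` is negative, so the printed
hypothesis fails — the exception (2.4) p. 424 is for the standard scalar line. [cite: Balaban1983Higgs3, (2.4) p.424] -/
theorem not_posSubgraphsExcept24_member24K_of_neg (q : ℚ) (hq : q ∈ P.menu) (hq0 : q < 0) {mb : ℕ} (h : 1 ≤ mb)
    (D : DatumZB P.toParamsZB) :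
    ¬ PosSubgraphsExcept24 (expansionZK P mb D) (CGraphZK.ofZB (member24 P.toParamsZB μ' ν' h) q hq hq0.le) := by
  rintro ⟨-, hall⟩
  change ∀ H : Component (G24 P.toParamsZB μ' ν'),
    Is24K (relabelCounts (G24 P.toParamsZB μ' ν') H.1) ((fun _ : Fin 1 => q) ∘ H.1) H.2.1 H.2.2.1 ∨
      0 < degQK (relabelCounts (G24 P.toParamsZB μ' ν') H.1) ((fun _ : Fin 1 => q) ∘ H.1) H.2.1 H.2.2.1 at hall
  have hrep : (0 : Fin 2) ∈ (relabelCounts (G24 P.toParamsZB μ' ν') 1).toModel.reps ((1 : Fin 2) : ℕ) := by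
    rw [relabelCounts_G24, Model.mem_reps]; exact rep_one_G24 P.toParamsZB μ' ν' 0
  have hnt : (relabelCounts (G24 P.toParamsZB μ' ν') 1).toModel.Nontriv ((1 : Fin 2) : ℕ) 0 := by
    rw [relabelCounts_G24]
    change ((G24 P.toParamsZB μ' ν').toModel.before 1 0).Nonempty
    rw [before_one_G24]; exact singleton_nonempty 0
  have h1 := hall ⟨1, 1, 0, hrep, hnt⟩
  change Is24K (relabelCounts (G24 P.toParamsZB μ' ν') 1) ((fun _ : Fin 1 => q) ∘ (1 : Equiv.Perm (Fin 1)))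
      ((1 : Fin 2) : ℕ) 0 ∨
    0 < degQK (relabelCounts (G24 P.toParamsZB μ' ν') 1) ((fun _ : Fin 1 => q) ∘ (1 : Equiv.Perm (Fin 1)))
      ((1 : Fin 2) : ℕ) 0 at h1
  rw [relabelCounts_G24, Fin.val_one] at h1
  rcases h1 with h24 | hpos
  · have hz := h24.2 0 (by rw [before_one_G24]; exact mem_singleton_self 0)
    exact hq0.ne hz
  · unfold degQK at hpos
    rw [degQ_G24, before_one_G24, sum_singleton] at hpos
    have : (0 : ℚ) < 0 + q := hpos
    linarith

end Graph24

end

end B3FreeLineZeroBox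

end Literature.MathematicalPhysics.QuantumFieldTheory.Balaban1983to89
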